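import Summits.Ventures.PercRepro.SixFourT3A

/-!
# PercRepro — C-025 at `(6,4)`, Proposition 21.9, part B: the plane counts (p3, gen 8)

The plane-level counts of mine-2 §21.9 for the cell `Cell10` of part A: with `a₄` / `a₅` = the planes of `M`
meeting `G` in exactly `4` / `5` points of rank `3`,

* `e₅ ≤ a₅` (`e5_le_a5`: a rank-`3` `5`-subset is the full trace of its closure plane);
* `pp + 2·lpp = Σ_{B′ ∈ R₄(G), |B′| ≥ 5} m(B′)` (`pp_add_two_lpp`) `= #{(B″, x) : B″ ⊆ G of rank 3 with ≥ 4 points,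
  x ∈ G ∖ cl(B″)}` (`sum_mTr_eq_sum_coloopPairs`: `(B′, x) ↦ (B′ ∖ x, x)`) `≤ 6·a₄ + 30·a₅`
  (`sum_coloopPairs_le`: grouped by the closure plane, a `4`-point trace carries one `B″` with `6` choices of `x`,
  a `5`-point trace at most `6` sets `B″` with `5` choices each).

Part C (`SixFourT3.lean`) proves `3a₄ + 6a₅ ≤ C(10,3)` and assembles the inequality.  The double count
`pp_add_two_lpp` / `sum_mTr_eq_sum_offCl` and the closure-plane lemmas need only `G ⊆ E` (reused by §22.1).
-/

namespace PercRepro.SixFour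

open Finset ThmH

variable {α : Type*} [DecidableEq α] {M : Matroid α} [M.Finite] {G : Finset α}

/-! ## The plane counts `a₄`, `a₅` -/

/-- The planes meeting `G` in exactly `c` points, of rank `3`. -/
noncomputable def planesTrace (M : Matroid α) [M.Finite] (G : Finset α) (c : ℕ) : Finset (Finset α) :=
  (planes M).filter (fun P : Finset α => (P ∩ G).card = c ∧ M.eRk ((P ∩ G : Finset α) : Set α) = 3)

/-- `a₄(G)`: the planes whose trace on `G` has `4` points (and rank `3`). -/
noncomputable def a4 (M : Matroid α) [M.Finite] (G : Finset α) : ℕ := (planesTrace M G 4).card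

/-- `a₅(G)`: the planes whose trace on `G` has `5` points (and rank `3`). -/
noncomputable def a5 (M : Matroid α) [M.Finite] (G : Finset α) : ℕ := (planesTrace M G 5).card

/-- `planesTrace M G c ⊆ planes M`. -/
theorem planesTrace_subset (c : ℕ) : planesTrace M G c ⊆ planes M := Finset.filter_subset _ _

/-- Membership in `planesTrace`. -/
theorem mem_planesTrace {c : ℕ} {P : Finset α} :
    P ∈ planesTrace M G c ↔ P ∈ planes M ∧ (P ∩ G).card = c ∧ M.eRk ((P ∩ G : Finset α) : Set α) = 3 := by
  unfold planesTrace
  rw [Finset.mem_filter]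

/-- A rank-`3` subset of `G` with `c ≥ 4` points and its closure: the closure is a plane whose trace on `G`
contains the set and has rank `3`. -/
theorem clF_mem_planes_of_rank_three (hG : G ⊆ gr M) {B : Finset α} (hB : B ⊆ G)
    (hr : M.eRk (B : Set α) = 3) :
    clF M B ∈ planes M ∧ B ⊆ clF M B ∩ G ∧ M.eRk ((clF M B ∩ G : Finset α) : Set α) = 3 := by
  obtain ⟨hP, hBP⟩ := clF_mem_planes (hB.trans hG) hr
  refine ⟨hP, Finset.subset_inter hBP hB, le_antisymm ?_ ?_⟩
  · rw [← (mem_planes.1 hP).2.2]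
    exact M.eRk_mono (Finset.coe_subset.2 Finset.inter_subset_left)
  · rw [← hr]
    exact M.eRk_mono (Finset.coe_subset.2 (Finset.subset_inter hBP hB))

/-- A rank-`≤ 3` `5`-subset of `G` has rank exactly `3`. -/
theorem eRk_eq_three_of_card_five (hs : Simple M) (h : Cell10 M G) {B : Finset α} (hB : B ⊆ G)
    (hc : B.card = 5) (hr : M.eRk (B : Set α) ≤ 3) : M.eRk (B : Set α) = 3 := by
  refine eRk_eq_of_le_of_not_le (n := 2) hr (fun h2 => ?_)
  have := card_le_four_of_eRk_le_two hs h hB h2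
  omega

/-- A rank-`3` `5`-subset of `G` is the whole trace of its closure plane. -/
theorem clF_inter_eq_of_card_five (h : Cell10 M G) {B : Finset α} (hB : B ⊆ G) (hc : B.card = 5)
    (hr : M.eRk (B : Set α) = 3) : clF M B ∩ G = B := by
  obtain ⟨hP, hsub, -⟩ := clF_mem_planes_of_rank_three h.subset hB hr
  have hle := h.plane_le _ hP
  exact (Finset.eq_of_subset_of_card_le hsub (by omega)).symm

/-- `e₅ ≤ a₅`: `B ↦ cl(B)` injects the rank-`3` `5`-subsets into the planes with a `5`-point trace. -/
theorem e5_le_a5 (hs : Simple M) (h : Cell10 M G) : e5 M G ≤ a5 M G := by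
  unfold e5 a5
  refine Finset.card_le_card_of_injOn (fun B => clF M B) ?_ ?_
  · intro B hB
    rw [Finset.coe_filter] at hB
    obtain ⟨hB, hr⟩ := hB
    obtain ⟨hBG, hc⟩ := Finset.mem_powersetCard.1 hB
    have hr3 := eRk_eq_three_of_card_five hs h hBG hc hr
    obtain ⟨hP, -, hrP⟩ := clF_mem_planes_of_rank_three h.subset hBG hr3
    rw [Finset.mem_coe, mem_planesTrace, clF_inter_eq_of_card_five h hBG hc hr3]
    exact ⟨hP, hc, hr3⟩
  · intro B₁ hB₁ B₂ hB₂ heq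
    rw [Finset.coe_filter] at hB₁ hB₂
    obtain ⟨hB₁, hr₁⟩ := hB₁
    obtain ⟨hB₂, hr₂⟩ := hB₂
    obtain ⟨hBG₁, hc₁⟩ := Finset.mem_powersetCard.1 hB₁
    obtain ⟨hBG₂, hc₂⟩ := Finset.mem_powersetCard.1 hB₂
    have heq' : clF M B₁ = clF M B₂ := heq
    rw [← clF_inter_eq_of_card_five h hBG₁ hc₁ (eRk_eq_three_of_card_five hs h hBG₁ hc₁ hr₁),
      ← clF_inter_eq_of_card_five h hBG₂ hc₂ (eRk_eq_three_of_card_five hs h hBG₂ hc₂ hr₂), heq']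

/-! ## `pp + 2·lpp` as a sum of `m(B′)` over the rank-`4` sets with `≥ 5` points -/

/-- The rank-`4` subsets of `G` with at least `5` points. -/
noncomputable def R5 (M : Matroid α) [M.Finite] (G : Finset α) : Finset (Finset α) :=
  (R4 M G).filter (fun B : Finset α => 5 ≤ B.card)

/-- A rank-`4` set with `m = k ≤ 2` has at least `5` points. -/
theorem filter_mTr_eq_R5 (G : Finset α) {k : ℕ} (hk : k ≤ 2) :
    (R4 M G).filter (fun B : Finset α => mTr M B = k) = (R5 M G).filter (fun B : Finset α => mTr M B = k) := by
  unfold R5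
  rw [Finset.filter_filter]
  refine Finset.filter_congr (fun B hB => ?_)
  obtain ⟨-, hr⟩ := mem_R4.1 hB
  constructor
  · intro hm
    refine ⟨?_, hm⟩
    have h4 := four_le_card_of_eRk_eq_four hr
    by_contra h5
    have hc : B.card = 4 := by omega
    have := mTr_eq_four_of_card_eq_four hr hc
    omega
  · exact fun hm => hm.2

/-- `pp + 2·lpp = Σ_{B′ ∈ R₅(G)} m(B′)`. -/
theorem pp_add_two_lpp (hs : Simple M) (hG : G ⊆ gr M) :
    pp M G + 2 * lpp M G = ∑ B ∈ R5 M G, mTr M B := by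
  have hpt : ∀ B ∈ R5 M G, mTr M B = (if mTr M B = 1 then 1 else 0) + (if mTr M B = 2 then 2 else 0) := by
    intro B hB
    unfold R5 at hB
    obtain ⟨hB4, h5⟩ := Finset.mem_filter.1 hB
    obtain ⟨hBG, hr⟩ := mem_R4.1 hB4
    have hle := mTr_le_two_of_five_le hs (hBG.trans hG) hr h5
    have : mTr M B = 0 ∨ mTr M B = 1 ∨ mTr M B = 2 := by omega
    rcases this with h | h | h <;> simp [h]
  rw [Finset.sum_congr rfl hpt, Finset.sum_add_distrib, ← Finset.sum_filter, ← Finset.sum_filter,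
    Finset.sum_const, Finset.sum_const, smul_eq_mul, smul_eq_mul, mul_one]
  unfold pp lpp
  rw [filter_mTr_eq_R5 G (by norm_num : 1 ≤ 2), filter_mTr_eq_R5 G (by norm_num : 2 ≤ 2)]
  ring

/-! ## The double count `Σ m(B′) = #{(B″, x)}` -/

/-- The rank-`3` subsets of `G` with at least `4` points. -/
noncomputable def T3 (M : Matroid α) [M.Finite] (G : Finset α) : Finset (Finset α) :=
  G.powerset.filter (fun B : Finset α => M.eRk (B : Set α) = 3 ∧ 4 ≤ B.card)

/-- The points of `G` outside the closure of `B`. -/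
noncomputable def offCl (M : Matroid α) [M.Finite] (G B : Finset α) : Finset α :=
  G.filter (fun x => x ∉ clF M B)

omit [DecidableEq α] in
/-- Membership in `T3`. -/
theorem mem_T3 {B : Finset α} : B ∈ T3 M G ↔ B ⊆ G ∧ M.eRk (B : Set α) = 3 ∧ 4 ≤ B.card := by
  unfold T3
  rw [Finset.mem_filter, Finset.mem_powerset]

/-- Membership in `offCl`. -/
theorem mem_offCl {B x : _} : x ∈ offCl M G B ↔ x ∈ G ∧ x ∉ M.closure (B : Set α) := by
  unfold offCl
  rw [Finset.mem_filter, mem_clF]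

/-- `(B′, x) ↦ (B′ ∖ x, x)` is a bijection from `{(B′, x) : B′ ∈ R₅, x a coloop of M|B′}` onto
`{(B″, x) : B″ ∈ T₃, x ∈ G ∖ cl(B″)}`, so `Σ_{B′ ∈ R₅} m(B′) = Σ_{B″ ∈ T₃} |G ∖ cl(B″)|`. -/
theorem sum_mTr_eq_sum_offCl (hG : G ⊆ gr M) :
    ∑ B ∈ R5 M G, mTr M B = ∑ B ∈ T3 M G, (offCl M G B).card := by
  unfold mTr
  rw [← Finset.card_sigma, ← Finset.card_sigma]
  refine Finset.card_nbij' (fun p : (Σ _ : Finset α, α) => (⟨p.1.erase p.2, p.2⟩ : Σ _ : Finset α, α))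
    (fun p : (Σ _ : Finset α, α) => (⟨insert p.2 p.1, p.2⟩ : Σ _ : Finset α, α)) ?_ ?_ ?_ ?_
  · rintro ⟨B, x⟩ hp
    simp only [Finset.mem_coe, Finset.mem_sigma] at hp ⊢
    obtain ⟨hB, hx⟩ := hp
    unfold R5 at hB
    obtain ⟨hB4, h5⟩ := Finset.mem_filter.1 hB
    obtain ⟨hBG, hr⟩ := mem_R4.1 hB4
    obtain ⟨hxB, hcl⟩ := mem_coloopsOf.1 hx
    refine ⟨?_, ?_⟩
    · rw [mem_T3]
      refine ⟨(Finset.erase_subset x B).trans hBG, ?_, ?_⟩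
      · have := eRk_erase_add_one_of_notMem_closure (hBG.trans hG) hxB hcl
        rw [hr] at this
        have h3 : M.eRk ((B.erase x : Finset α) : Set α) + 1 = (3 : ℕ∞) + 1 := by rw [this]; rfl
        exact WithTop.add_right_cancel WithTop.one_ne_top h3
      · rw [Finset.card_erase_of_mem hxB]
        omega
    · rw [mem_offCl]
      exact ⟨hBG hxB, hcl⟩
  · rintro ⟨B, x⟩ hp
    simp only [Finset.mem_coe, Finset.mem_sigma] at hp ⊢
    obtain ⟨hB, hx⟩ := hp
    obtain ⟨hBG, hr, h4⟩ := mem_T3.1 hB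
    obtain ⟨hxG, hcl⟩ := mem_offCl.1 hx
    have hxE : x ∈ M.E := by rw [← coe_gr M]; exact Finset.mem_coe.2 (hG hxG)
    have hxB : x ∉ B := fun hxB => hcl (M.mem_closure_of_mem' (Finset.mem_coe.2 hxB) hxE)
    refine ⟨?_, ?_⟩
    · unfold R5
      rw [Finset.mem_filter, mem_R4]
      refine ⟨⟨Finset.insert_subset hxG hBG, ?_⟩, ?_⟩
      · rw [Finset.coe_insert, Matroid.eRk_insert_eq_add_one ⟨hxE, hcl⟩, hr]
        rfl
      · rw [Finset.card_insert_of_notMem hxB]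
        omega
    · rw [mem_coloopsOf, Finset.erase_insert hxB]
      exact ⟨Finset.mem_insert_self x B, hcl⟩
  · rintro ⟨B, x⟩ hp
    simp only [Finset.mem_coe, Finset.mem_sigma] at hp
    have hxB : x ∈ B := (mem_coloopsOf.1 hp.2).1
    show (⟨insert x (B.erase x), x⟩ : Σ _ : Finset α, α) = ⟨B, x⟩
    rw [Finset.insert_erase hxB]
  · rintro ⟨B, x⟩ hp
    simp only [Finset.mem_coe, Finset.mem_sigma] at hp
    obtain ⟨hB, hx⟩ := hp
    obtain ⟨hBG, -, -⟩ := mem_T3.1 hB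
    obtain ⟨hxG, hcl⟩ := mem_offCl.1 hx
    have hxE : x ∈ M.E := by rw [← coe_gr M]; exact Finset.mem_coe.2 (hG hxG)
    have hxB : x ∉ B := fun hxB => hcl (M.mem_closure_of_mem' (Finset.mem_coe.2 hxB) hxE)
    show (⟨(insert x B).erase x, x⟩ : Σ _ : Finset α, α) = ⟨B, x⟩
    rw [Finset.erase_insert hxB]

/-! ## The fibres over the planes: `Σ_{B″ ∈ T₃} |G ∖ cl(B″)| ≤ 6·a₄ + 30·a₅` -/

/-- `G ∖ cl(B)` is the complement of the trace `cl(B) ∩ G` in `G`. -/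
theorem offCl_eq_sdiff (B : Finset α) : offCl M G B = G \ (clF M B ∩ G) := by
  ext x
  unfold offCl
  rw [Finset.mem_filter, Finset.mem_sdiff, Finset.mem_inter]
  tauto

/-- `|G ∖ cl(B)| + |cl(B) ∩ G| = 10`. -/
theorem card_offCl_add (h : Cell10 M G) (B : Finset α) : (offCl M G B).card + (clF M B ∩ G).card = 10 := by
  rw [offCl_eq_sdiff, Finset.card_sdiff_add_card_eq_card Finset.inter_subset_right, h.card]

omit [DecidableEq α] in
/-- The subsets with at least `4` points of a `4`-set: exactly one. -/
theorem card_powerset_filter_four_le_of_card_four {ρ : Finset α} (hc : ρ.card = 4) :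
    (ρ.powerset.filter (fun B : Finset α => 4 ≤ B.card)).card = 1 := by
  rw [Finset.card_eq_one]
  refine ⟨ρ, ?_⟩
  ext B
  rw [Finset.mem_filter, Finset.mem_powerset, Finset.mem_singleton]
  constructor
  · rintro ⟨hB, h4⟩
    exact Finset.eq_of_subset_of_card_le hB (by omega)
  · rintro rfl
    exact ⟨Finset.Subset.refl _, by omega⟩

omit [DecidableEq α] in
/-- The subsets with at least `4` points of a `5`-set: `C(5,4) + C(5,5) = 6`. -/
theorem card_powerset_filter_four_le_of_card_five {ρ : Finset α} (hc : ρ.card = 5) :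
    (ρ.powerset.filter (fun B : Finset α => 4 ≤ B.card)).card = 6 := by
  rw [Finset.powerset_card_disjiUnion, Finset.filter_disjiUnion, Finset.card_disjiUnion, hc]
  simp only [Finset.sum_range_succ, Finset.sum_range_zero]
  have hnone : ∀ i, i ≤ 3 → ((ρ.powersetCard i).filter (fun B : Finset α => 4 ≤ B.card)).card = 0 := by
    intro i hi
    rw [Finset.card_eq_zero, Finset.filter_false_of_mem]
    intro B hB
    rw [(Finset.mem_powersetCard.1 hB).2]
    omega
  have hall : ∀ i, 4 ≤ i → ((ρ.powersetCard i).filter (fun B : Finset α => 4 ≤ B.card)).card =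
      Nat.choose 5 i := by
    intro i hi
    rw [Finset.filter_true_of_mem, Finset.card_powersetCard, hc]
    intro B hB
    rw [(Finset.mem_powersetCard.1 hB).2]
    exact hi
  rw [hnone 0 (by norm_num), hnone 1 (by norm_num), hnone 2 (by norm_num), hnone 3 (by norm_num),
    hall 4 (by norm_num), hall 5 (by norm_num)]
  rfl

/-- The fibre of `T₃` over a plane `P` lies in the subsets of the trace `P ∩ G` with at least `4` points. -/
theorem fiber_subset (hG : G ⊆ gr M) (P : Finset α) :
    (T3 M G).filter (fun B : Finset α => clF M B = P) ⊆
      (P ∩ G).powerset.filter (fun B : Finset α => 4 ≤ B.card) := by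
  intro B hB
  rw [Finset.mem_filter] at hB
  obtain ⟨hB, hP⟩ := hB
  obtain ⟨hBG, hr, h4⟩ := mem_T3.1 hB
  rw [Finset.mem_filter, Finset.mem_powerset]
  refine ⟨Finset.subset_inter ?_ hBG, h4⟩
  rw [← hP, ← Finset.coe_subset, coe_clF]
  exact M.subset_closure _ (by rw [← coe_gr M]; exact Finset.coe_subset.2 (hBG.trans hG))

/-- A nonempty fibre over `P` forces the trace `P ∩ G` to have rank `3` (it contains a rank-`3` set). -/
theorem eRk_trace_eq_three_of_mem_fiber (hG : G ⊆ gr M) {P B : Finset α}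
    (hB : B ∈ (T3 M G).filter (fun B : Finset α => clF M B = P)) :
    M.eRk ((P ∩ G : Finset α) : Set α) = 3 := by
  rw [Finset.mem_filter] at hB
  obtain ⟨hB, hP⟩ := hB
  obtain ⟨hBG, hr, -⟩ := mem_T3.1 hB
  obtain ⟨-, -, hr3⟩ := clF_mem_planes_of_rank_three hG hBG hr
  rwa [hP] at hr3

/-- The contribution of one plane: `#fibre · (10 − |P ∩ G|) ≤ 6·[|P ∩ G| = 4] + 30·[|P ∩ G| = 5]`. -/
theorem fiber_contribution_le (h : Cell10 M G) {P : Finset α} (hP : P ∈ planes M) :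
    ((T3 M G).filter (fun B : Finset α => clF M B = P)).card * (10 - (P ∩ G).card) ≤
      (if P ∈ planesTrace M G 4 then 6 else 0) + (if P ∈ planesTrace M G 5 then 30 else 0) := by
  set F := (T3 M G).filter (fun B : Finset α => clF M B = P) with hF
  have hle := h.plane_le _ hP
  by_cases hne : F = ∅
  · rw [hne, Finset.card_empty, zero_mul]
    exact Nat.zero_le _
  · obtain ⟨B, hB⟩ := Finset.nonempty_iff_ne_empty.2 hne
    have hr3 := eRk_trace_eq_three_of_mem_fiber h.subset hB
    have hsub := Finset.card_le_card (fiber_subset h.subset P)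
    have h4 : 4 ≤ (P ∩ G).card := by
      have := fiber_subset h.subset P hB
      rw [Finset.mem_filter, Finset.mem_powerset] at this
      exact this.2.trans (Finset.card_le_card this.1)
    have hc : (P ∩ G).card = 4 ∨ (P ∩ G).card = 5 := by omega
    rcases hc with hc | hc
    · have h4' : P ∈ planesTrace M G 4 := mem_planesTrace.2 ⟨hP, hc, hr3⟩
      have h5' : P ∉ planesTrace M G 5 := fun h5 => by
        have := (mem_planesTrace.1 h5).2.1
        omega
      rw [if_pos h4', if_neg h5', hc]
      rw [card_powerset_filter_four_le_of_card_four hc] at hsub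
      rw [← hF] at hsub
      omega
    · have h4' : P ∉ planesTrace M G 4 := fun h4 => by
        have := (mem_planesTrace.1 h4).2.1
        omega
      have h5' : P ∈ planesTrace M G 5 := mem_planesTrace.2 ⟨hP, hc, hr3⟩
      rw [if_neg h4', if_pos h5', hc]
      rw [card_powerset_filter_four_le_of_card_five hc] at hsub
      rw [← hF] at hsub
      omega

/-- `Σ_{B″ ∈ T₃} |G ∖ cl(B″)| ≤ 6·a₄ + 30·a₅`. -/
theorem sum_offCl_le (h : Cell10 M G) :
    ∑ B ∈ T3 M G, (offCl M G B).card ≤ 6 * a4 M G + 30 * a5 M G := by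
  have hmaps : ∀ B ∈ T3 M G, clF M B ∈ planes M := by
    intro B hB
    obtain ⟨hBG, hr, -⟩ := mem_T3.1 hB
    exact (clF_mem_planes_of_rank_three h.subset hBG hr).1
  rw [← Finset.sum_fiberwise_of_maps_to hmaps]
  have hfib : ∀ P ∈ planes M,
      ∑ B ∈ (T3 M G).filter (fun B : Finset α => clF M B = P), (offCl M G B).card =
        ((T3 M G).filter (fun B : Finset α => clF M B = P)).card * (10 - (P ∩ G).card) := by
    intro P hP
    rw [Finset.card_eq_sum_ones, Finset.sum_mul, one_mul]
    refine Finset.sum_congr rfl (fun B hB => ?_)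
    have hPB : clF M B = P := (Finset.mem_filter.1 hB).2
    have := card_offCl_add h B
    rw [hPB] at this
    omega
  rw [Finset.sum_congr rfl hfib]
  calc ∑ P ∈ planes M, ((T3 M G).filter (fun B : Finset α => clF M B = P)).card * (10 - (P ∩ G).card)
      ≤ ∑ P ∈ planes M, ((if P ∈ planesTrace M G 4 then 6 else 0) + (if P ∈ planesTrace M G 5 then 30 else 0)) :=
        Finset.sum_le_sum (fun P hP => fiber_contribution_le h hP)
    _ = 6 * a4 M G + 30 * a5 M G := by
        rw [Finset.sum_add_distrib, ← Finset.sum_filter, ← Finset.sum_filter, Finset.sum_const, Finset.sum_const,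
          smul_eq_mul, smul_eq_mul, Finset.filter_mem_eq_inter, Finset.filter_mem_eq_inter,
          Finset.inter_eq_right.2 (planesTrace_subset 4), Finset.inter_eq_right.2 (planesTrace_subset 5)]
        unfold a4 a5
        ring

/-- `pp + 2·lpp ≤ 6·a₄ + 30·a₅`. -/
theorem pp_add_two_lpp_le (hs : Simple M) (h : Cell10 M G) : pp M G + 2 * lpp M G ≤ 6 * a4 M G + 30 * a5 M G := by
  rw [pp_add_two_lpp hs h.subset, sum_mTr_eq_sum_offCl h.subset]
  exact sum_offCl_le h

end PercRepro.SixFour
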